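import Summits.Ventures.CertifiedManyBodySolver.Observables.PairLROOnePointCeiling
import Summits.Ventures.CertifiedManyBodySolver.Observables.PairWordD4
import HarnessLib

/-!
# One-point route, reading step: the space-group-averaged torus state evaluates the one-point objective
# `Γ(incl) Φ₀` by the pair field per site (point groups on which the form factor is invariant)

HONEST FRAMING: first certified bounds on pairing observables; not a superconductivity verdict; every
number certified (two lineages + referee) or labelled float. Crew hubbard-obs (D-0042), seat hubbard-obs-p1
(`prover-hubbard-obs-p1-g5-0`). Zero compute; no definition; no named fact; no `sorry`.

The certificate-side theorems of the RDM bootstrap (`…WindowCertificate…`, and the variational tier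
`OrbitStateVariationalCertificate` + its window pull-back) conclude with the ORBIT STATE of a torus vector `ζ`
over the space-group unitaries `(U_w D_γ)_{w ∈ (ℤ/Lℤ)², γ ∈ S}` evaluated on the pulled-back objective,
`Re ω̄_ζ(Γ(ι_{Λ'}) X)`. The summit-format corollary `liminf_pairFieldLRO_le_of_onePoint_variational_bound`
(PairLROOnePointCeiling) consumes the ONE-POINT bound in the form `… ≤ −Re⟨ζ, Δ_g ζ⟩/L²`. This file is the
dictionary between the two for the one-point objective `X = Γ(incl) Φ₀`, `Φ₀ = localPairAt {0,±e₁,±e₂} g 0`: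

* `re_orbitState_spaceGroupUnitary_localPairAt` — for a point group `S ≠ ∅` on which the form factor is
  INVARIANT (`g(γe) = g(e)`, `γ ∈ S`; for `g = g_d`: `S ⊆ D₂ = {1, R², the two axis reflections}`, i.e.
  `b1gSign γ = 1`) and a window `Λ' ⊇ pairRegion S_• 0` fitting into the torus:
  `Re ω̄_ζ(Γ(ι_{Λ'}) Γ(incl) Φ₀) = Re⟨ζ, Δ_g ζ⟩/L²` (each `γ ∈ S` contributes the translation average of
  `Γ(d4Emb γ 0) Φ₀ = Φ_{γ0} = Φ₀`, which is `⟨ζ, Δ_g ζ⟩/L²`). HONEST: for `γ` with `g(γe) = −g(e)` (quarter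
  turns, diagonal reflections for `g_d`) the contribution flips sign, so a certificate using such symmetry rows
  is NOT read by this chain (the engine's "twisted" `R∘γ_{π/2}` identification has no orbit-unitary family
  in the tree); `dWaveFormFactor_d4Vec_of_b1gSign_eq_one` records the admissible `γ`.
* **`liminf_pairFieldLRO_le_of_onePoint_orbitState_bound`** — the corollary restated with the one-point bound
  in orbit-state form: `c − A + Σ_σ μ_σ(Re⟨ζ,N_σζ⟩/L² − ν) + κ(u − Re⟨ζ,H_Lζ⟩/L²) ≤ Re ω̄_ζ(Γ(ι_{Λ'})(−Γ(incl) Φ₀))`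
  for every unit `ζ` of every torus of side `≥ L₁` ⇒ `liminf_k u_k ≤ 2M²`; and the registry consumer
  `M3ObsPairLROCeilingAt_tp0_of_onePoint_orbitState_bound` at `(8, 7/8, 0)`, `g = g_d`.
What remains between an OP1-E certificate identity and these hypotheses is exactly ONE application of the
variational window-certificate theorem (torus level) per side `L`.

References: O. Bratteli, D. W. Robinson, *Operator Algebras and Quantum Statistical Mechanics 2* (1997)
§6.2.4 [BratteliRobinsonII1997]; D. J. Scalapino, Phys. Rep. 250 (1995) 329, §2 eq. (2.2)–(2.4)
[Scalapino1995]; T. Koma, H. Tasaki, J. Stat. Phys. 76 (1994) 745, Theorem 2.2 [KomaTasaki1994].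
-/

noncomputable section

namespace Summit.Ventures.CertifiedManyBodySolver.Observables

open Matrix Complex Finset Literature.MathematicalPhysics.QuantumLattice Literature.Probability.LatticeModels
open Literature.MathematicalPhysics.QuantumLattice.HubbardWave0 ThermodynamicLimit Filter Topology
open Literature.MathematicalPhysics.QuantumManyBody.StateRelaxation
open Summit.Ventures.CertifiedManyBodySolver.Transport
open scoped ComplexOrder ComplexConjugate BigOperators

/-! ### §1  The reading lemma -/

section Reading

variable {L : ℕ} [NeZero L] (g : Site 2 → ℝ)

/-- **The space-group-averaged torus state reads the one-point objective as the pair field per site.**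
For a nonempty point group `S ⊆ D₄` on which the form factor is invariant (`g(γe) = g(e)` for `γ ∈ S`,
`e ∈ {0, ±e₁, ±e₂}`), a window `Λ' ⊇ pairRegion {0,±e₁,±e₂} 0` with `x ↦ x mod L` injective on it, and any
torus vector `ζ`: `Re ω̄_ζ(Γ(ι_{Λ'}) Γ(incl) Φ₀^g) = Re⟨ζ, Δ_g ζ⟩/L²`.
[cite: BratteliRobinsonII1997, §6.2.4] [cite: Scalapino1995, §2 eq. (2.2)] -/
theorem re_orbitState_spaceGroupUnitary_localPairAt {S : Finset (DihedralGroup 4)} (hS : S.Nonempty)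
    (hg : ∀ γ ∈ S, ∀ e ∈ insert (0 : Site 2) unitSteps, g (d4Vec γ e) = g e)
    {Λ' : Finset (Site 2)} (h0 : pairRegion (insert (0 : Site 2) unitSteps) 0 ⊆ Λ')
    (hInj' : Set.InjOn (Torus.proj (d := 2) L) ↑Λ') (ζ : Fock (Orb (FermionTorus 2 L))) :
    (orbitState (spaceGroupUnitary S) ζ (fermionEmbed (PolySite.toTorusEmb L hInj')
        (fermionEmbed (PolySite.incl h0) (localPairAt (insert (0 : Site 2) unitSteps) g 0)))).re =
      (expect (pairField g L) ζ).re / (L : ℝ) ^ 2 := by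
  set Sd : Finset (Site 2) := insert (0 : Site 2) unitSteps with hSd
  have hInj0 : Set.InjOn (Torus.proj (d := 2) L) ↑(pairRegion Sd 0) := hInj'.mono (by exact_mod_cast h0)
  -- each `γ ∈ S` contributes `Re⟨ζ, Δ_g ζ⟩/L²`
  have hterm : ∀ γ ∈ S, (torusAvgExpectAt L (d4ShiftSet γ 0 Λ')
      (fermionEmbed (PolySite.d4Emb γ 0 Λ') (fermionEmbed (PolySite.incl h0) (localPairAt Sd g 0))) ζ).re =
        (expect (pairField g L) ζ).re / (L : ℝ) ^ 2 := by
    intro γ hγ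
    have hInjγ : Set.InjOn (Torus.proj (d := 2) L) ↑(d4ShiftSet γ 0 Λ') :=
      (injOn_proj_d4ShiftSet_iff L γ 0 Λ').2 hInj'
    have hInjγ0 : Set.InjOn (Torus.proj (d := 2) L) ↑(d4ShiftSet γ 0 (pairRegion Sd 0)) :=
      hInjγ.mono (by exact_mod_cast d4ShiftSet_mono γ 0 h0)
    have hg1 : ∀ e ∈ insert (0 : Site 2) unitSteps, g (d4Vec γ e) = 1 * g e := fun e he => by
      rw [one_mul]; exact hg γ hγ e he
    rw [fermionEmbed_d4Emb_fermionEmbed_incl γ 0 h0, fermionEmbed_d4Emb_localPairAt γ 0 0 g 1 hg1 (one_mul 1),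
      Complex.ofReal_one, one_smul, torusAvgExpectAt_fermionEmbed_incl L (d4ShiftSet_mono γ 0 h0) hInjγ,
      torusAvgExpectAt_fermionEmbed_incl L (pairRegion_d4Vec_subset γ 0 0) hInjγ0]
    have hz : d4Vec γ 0 + 0 = 0 := by rw [add_zero]; exact (d4Vec_eq_zero_iff γ 0).2 rfl
    rw [hz, torusAvgExpectAt_localPairAt_eq_expect_pairField_div g hInj0 ζ, ← Complex.ofReal_natCast,
      ← Complex.ofReal_pow, Complex.div_ofReal_re]
  rw [re_orbitState_spaceGroupUnitary_fermionEmbed_toTorusEmb S hInj', Finset.sum_congr rfl hterm,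
    Finset.sum_const, nsmul_eq_mul, ← mul_assoc,
    inv_mul_cancel₀ (Nat.cast_ne_zero.2 (Finset.card_pos.2 hS).ne'), one_mul]

/-- The admissible point-group elements for the `d`-wave one-point objective: `g_d(γe) = g_d(e)` on
`{0, ±e₁, ±e₂}` whenever `b1gSign γ = 1` (`γ ∈ D₂ = {1, R², axis reflections}`).
[cite: Scalapino1995, §2 eq. (2.3)] -/
theorem dWaveFormFactor_d4Vec_of_b1gSign_eq_one {γ : DihedralGroup 4} (hγ : b1gSign γ = 1)
    (e : Site 2) : dWaveFormFactor (d4Vec γ e) = dWaveFormFactor e := by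
  rw [dWaveFormFactor_d4Vec_eq_b1gSign_mul γ e, hγ, one_mul]

end Reading

/-! ### §2  The corollary with the one-point bound in orbit-state form -/

section Family

variable (g : Site 2 → ℝ)

/-- **`liminf u_k ≤ 2M²` from a one-point bound in ORBIT-STATE form.** As
`liminf_pairFieldLRO_le_of_onePoint_variational_bound`, with the hypothesis stated the way the certificate
theorems conclude: for a nonempty point group `S` on which `g` is invariant, a window `Λ' ⊇ pairRegion S_• 0`,
and every side `L ≥ L₁` at which `Λ'` fits into the torus, every unit `ζ` obeys
`c − A + Σ_σ μ_σ(Re⟨ζ,N_σζ⟩/L² − ν) + κ(u − Re⟨ζ,H_Lζ⟩/L²) ≤ Re ω̄_ζ(Γ(ι_{Λ'})(−Γ(incl) Φ₀^g))`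
(`H_L = hubbardTorus 2 L t U`). Then every family of unit `(rectN n L, S^z = 0)`-sector ground states has
`liminf_k u_k ≤ 2(c − A + (Σ_σ μ_σ)(n/2 − ν))²`. [cite: KomaTasaki1994, Theorem 2.2]
[cite: BratteliRobinsonII1997, §6.2.4] -/
theorem liminf_pairFieldLRO_le_of_onePoint_orbitState_bound (t : ℝ) {U n : ℝ} (hU : 0 ≤ U)
    (hn0 : 0 ≤ n) (hn2 : n < 2) {c A κ u ν : ℝ} (μ : Fin 2 → ℝ) (hκ : 0 ≤ κ)
    (hu : energyDensityTT' t 0 U n ≤ u)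
    {S : Finset (DihedralGroup 4)} (hS : S.Nonempty)
    (hg : ∀ γ ∈ S, ∀ e ∈ insert (0 : Site 2) unitSteps, g (d4Vec γ e) = g e)
    {Λ' : Finset (Site 2)} (h0 : pairRegion (insert (0 : Site 2) unitSteps) 0 ⊆ Λ') (L₁ : ℕ)
    (hInj : ∀ L : ℕ, L₁ ≤ L → Set.InjOn (Torus.proj (d := 2) L) ↑Λ')
    (hbound : ∀ (L : ℕ) [NeZero L] (hL : L₁ ≤ L) (ζ : Fock (Orb (FermionTorus 2 L))), star ζ ⬝ᵥ ζ = 1 →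
      c - A + ∑ σ : Fin 2, μ σ *
          ((star ζ ⬝ᵥ ((∑ y : FermionTorus 2 L, numberOp y σ) *ᵥ ζ)).re / (L : ℝ) ^ 2 - ν) +
        κ * (u - (star ζ ⬝ᵥ (hubbardTorus 2 L t U *ᵥ ζ)).re / (L : ℝ) ^ 2) ≤
        (orbitState (spaceGroupUnitary S) ζ (fermionEmbed (PolySite.toTorusEmb L (hInj L hL))
          (-(fermionEmbed (PolySite.incl h0) (localPairAt (insert (0 : Site 2) unitSteps) g 0))))).re)
    (ψ : ∀ L, Fock (Orb (FermionTorus 2 L)))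
    (hψ : ∀ L, IsGroundStateInSector (hubbardTorus 2 L t U) (rectN n L) 0 (ψ L))
    (hψ1 : ∀ L, star (ψ L) ⬝ᵥ ψ L = 1) :
    liminf (fun k : ℕ => (∑ x ∈ halfOpenBox 2 (2 * k), ∑ y ∈ halfOpenBox 2 (2 * k),
        torusPullback (pairFieldCorr g ψ) (2 * k) x y) / ((#(halfOpenBox 2 (2 * k)) : ℝ)) ^ 2) atTop ≤
      2 * (c - A + (∑ σ : Fin 2, μ σ) * (n / 2 - ν)) ^ 2 := by
  refine liminf_pairFieldLRO_le_of_onePoint_variational_bound g t hU hn0 hn2 μ hκ hu L₁ ?_ ψ hψ hψ1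
  intro L _ hL ζ hζ
  have h := hbound L hL ζ hζ
  rwa [fermionEmbed_neg, map_neg, Complex.neg_re,
    re_orbitState_spaceGroupUnitary_localPairAt g hS hg h0 (hInj L hL) ζ] at h

/-- **Registry consumer, orbit-state form, at `(U, n, t') = (8, 7/8, 0)`, `g = g_d`.** Point group `S ≠ ∅`
with `b1gSign = 1` on `S`; window `Λ' ⊇ pairRegion S_• 0` fitting into every torus of side `≥ L₁`; the
one-point bound in orbit-state form for `H_L = hubbardTorus 2 L 1 8`; cap node `M3EnergyUpperRow 0 hi`,
`hi ≤ u`, `κ ≥ 0`; then `M3ObsPairLROCeilingAt_tp0 c'` for every rational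
`c' ≥ 2(c − A + (Σ_σ μ_σ)(7/16 − ν))²`. [cite: KomaTasaki1994, Theorem 2.2] -/
theorem M3ObsPairLROCeilingAt_tp0_of_onePoint_orbitState_bound {hi c' : ℚ} {c A κ u ν : ℝ}
    (μ : Fin 2 → ℝ) (hκ : 0 ≤ κ) (hE : M3EnergyUpperRow 0 hi) (hhi : ((hi : ℚ) : ℝ) ≤ u)
    {S : Finset (DihedralGroup 4)} (hS : S.Nonempty) (hS1 : ∀ γ ∈ S, b1gSign γ = 1)
    {Λ' : Finset (Site 2)} (h0 : pairRegion (insert (0 : Site 2) unitSteps) 0 ⊆ Λ') (L₁ : ℕ)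
    (hInj : ∀ L : ℕ, L₁ ≤ L → Set.InjOn (Torus.proj (d := 2) L) ↑Λ')
    (hbound : ∀ (L : ℕ) [NeZero L] (hL : L₁ ≤ L) (ζ : Fock (Orb (FermionTorus 2 L))), star ζ ⬝ᵥ ζ = 1 →
      c - A + ∑ σ : Fin 2, μ σ *
          ((star ζ ⬝ᵥ ((∑ y : FermionTorus 2 L, numberOp y σ) *ᵥ ζ)).re / (L : ℝ) ^ 2 - ν) +
        κ * (u - (star ζ ⬝ᵥ (hubbardTorus 2 L 1 8 *ᵥ ζ)).re / (L : ℝ) ^ 2) ≤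
        (orbitState (spaceGroupUnitary S) ζ (fermionEmbed (PolySite.toTorusEmb L (hInj L hL))
          (-(fermionEmbed (PolySite.incl h0)
            (localPairAt (insert (0 : Site 2) unitSteps) dWaveFormFactor 0))))).re)
    (hc' : 2 * (c - A + (∑ σ : Fin 2, μ σ) * ((7 / 8 : ℝ) / 2 - ν)) ^ 2 ≤ ((c' : ℚ) : ℝ)) :
    M3ObsPairLROCeilingAt_tp0 c' := by
  intro ψ hψ hψ1
  have hu : energyDensityTT' 1 0 8 (7 / 8) ≤ u :=
    (show energyDensityTT' 1 0 8 (7 / 8) ≤ ((hi : ℚ) : ℝ) from hE).trans hhi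
  have hψ' : ∀ L, IsGroundStateInSector (hubbardTorus 2 L 1 8) (rectN (7 / 8) L) 0 (ψ L) := fun L => by
    rw [← hubbardTorusTT'_zero]; exact hψ L
  have hg : ∀ γ ∈ S, ∀ e ∈ insert (0 : Site 2) unitSteps, dWaveFormFactor (d4Vec γ e) = dWaveFormFactor e :=
    fun γ hγ e _ => dWaveFormFactor_d4Vec_of_b1gSign_eq_one (hS1 γ hγ) e
  exact (liminf_pairFieldLRO_le_of_onePoint_orbitState_bound dWaveFormFactor 1 (by norm_num) (by norm_num)
    (by norm_num) μ hκ hu hS hg h0 L₁ hInj hbound ψ hψ' hψ1).trans hc'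

end Family

end Summit.Ventures.CertifiedManyBodySolver.Observables

end
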